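import Literature.NumberTheory.CubicFields.DeloneFaddeevFractionField
import Literature.NumberTheory.CubicFields.DavenportHeilbronnMaximalityConverse
import Literature.NumberTheory.CubicFields.CubicFieldForms
import HarnessLib

/-!
# Maximal irreducible cubic rings are exactly the maximal orders of cubic fields

Topic `Literature/NumberTheory/CubicFields`; the junction of
`DeloneFaddeevFractionField.lean` (`K_f = ℚ[x]/(f(x,1)) = Frac R(f)` for irreducible `f`),
`DavenportHeilbronnMaximality*.lean` (`RingOfForm.IsMaximal f ⇔ f ∈ U_p ∀ p`) and
`CubicFieldForms.lean` (`𝓞 K ≅ R(g)`, `Disc g = Disc K`).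

Bhargava–Taniguchi–Thorne 2023, §2.1: "Cubic fields are in bijection with their maximal orders …
a cubic ring `R` is the maximal order in a cubic field if and only if it is: (i) an integral domain;
and (ii) a maximal cubic ring." This file proves both halves for `R = R(f)`:

* `RingOfForm.toRingOfIntegers` — for irreducible `f`, the embedding `R(f) ↪ 𝓞 K_f`
  (elements of `R(f)` are integral), and **`RingOfForm.ringEquivRingOfIntegers`**: if moreover
  `R(f)` is maximal then `R(f) ≅ 𝓞 K_f` (maximality applied to `R(f) ↪ 𝓞 K_f ≅ R(g)`);
* **`RingOfForm.isMaximal_of_ringEquiv_ringOfIntegers`** — conversely the maximal order `𝓞 K`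
  of a (cubic) number field is a maximal cubic ring: an injective `φ : 𝓞 K ≅ R(g) → R(h)` has
  finite index `N`, so `y ↦ φ⁻¹(N y)/N` embeds `R(h)` into `K` by integral elements, i.e. into
  `𝓞 K`;
* `RingOfForm.isMaximal_and_isIrreducible_iff` — **`R(f)` is a maximal integral domain iff
  `R(f) ≅ 𝓞 K` for a cubic number field `K`** (BTT §2.1 (i)+(ii)), and with Prop. 2.2:
  `memU_and_isIrreducible_iff` — iff `f` is irreducible and `f ∈ U_p` for all primes `p`;
* consequences for the forms of cubic fields (`CubicFieldForms`): they are maximal at every `p`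
  (`memU_of_ringEquiv_ringOfIntegers`).

## References

* M. Bhargava, T. Taniguchi, F. Thorne, *Improved error estimates for the Davenport–Heilbronn
  theorems*, Math. Ann. 389 (2024) = arXiv:2107.12819, §2.1–2.2, Thm 2.1, Prop. 2.2 [BhargavaTaniguchiThorne2023].
* H. Davenport, H. Heilbronn, *On the density of discriminants of cubic fields. II*, Proc. Roy.
  Soc. London A 322 (1971) 405–420 [DavenportHeilbronn1971].
-/

namespace Literature.NumberTheory.CubicFields

namespace RingOfForm

open BinaryCubic NumberField

variable {f g : BinaryCubic ℤ}

/-! ### `R(f) ↪ 𝓞 K_f` and `R(f) ≅ 𝓞 K_f` for maximal irreducible `f` -/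

section Irreducible

variable [hf : Fact f.IsIrreducible]

/-- `ℤ → R(f) → K_f` is a scalar tower. [folklore] -/
instance : IsScalarTower ℤ (RingOfForm f) (RatAlgebra f) :=
  IsScalarTower.of_algebraMap_eq fun n => by simp

/-- **The embedding `R(f) ↪ 𝓞 K_f`** for irreducible `f`: every element of the finite `ℤ`-algebra
`R(f)` is integral, so `R(f) → K_f` lands in the ring of integers (Mathlib's
`IsIntegralClosure.lift`). [folklore] -/
noncomputable def toRingOfIntegers (f : BinaryCubic ℤ) [Fact f.IsIrreducible] :
    RingOfForm f →+* 𝓞 (RatAlgebra f) :=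
  (IsIntegralClosure.lift ℤ (𝓞 (RatAlgebra f)) (RatAlgebra f) (S := RingOfForm f)).toRingHom

/-- `toRingOfIntegers` followed by `𝓞 K_f ⊆ K_f` is `toAdjoinRoot`. [folklore] -/
@[simp] theorem algebraMap_toRingOfIntegers (x : RingOfForm f) :
    algebraMap (𝓞 (RatAlgebra f)) (RatAlgebra f) (toRingOfIntegers f x) = toAdjoinRoot f x :=
  IsIntegralClosure.algebraMap_lift ℤ (𝓞 (RatAlgebra f)) (RatAlgebra f) x

/-- `toRingOfIntegers` is injective. [folklore] -/
theorem toRingOfIntegers_injective : Function.Injective (toRingOfIntegers f) := by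
  intro x y h
  apply toAdjoinRoot_injective hf.out.1
  rw [← algebraMap_toRingOfIntegers, ← algebraMap_toRingOfIntegers, h]

/-- **A maximal irreducible `R(f)` is the maximal order of its cubic field**: if `R(f)` is maximal
then `R(f) ↪ 𝓞 K_f` is surjective (since `𝓞 K_f ≅ R(g)` is a cubic ring), so `R(f) ≅ 𝓞 K_f`
(BTT 2023, §2.1, "(i) and (ii) ⇒ maximal order"). [cite: BhargavaTaniguchiThorne2023, §2.1 (maximal cubic domain = maximal order of a cubic field)] -/
theorem toRingOfIntegers_surjective (hmax : IsMaximal f) : Function.Surjective (toRingOfIntegers f) := by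
  obtain ⟨g, ⟨e⟩⟩ := exists_ringOfForm_ringEquiv_ringOfIntegers (K := RatAlgebra f) finrank_ratAlgebra_eq_three
  have h := hmax g (e.symm.toRingHom.comp (toRingOfIntegers f)) (e.symm.injective.comp toRingOfIntegers_injective)
  intro y
  obtain ⟨x, hx⟩ := h (e.symm y)
  exact ⟨x, e.symm.injective hx⟩

/-- **`R(f) ≅ 𝓞 K_f`** for maximal irreducible `f`. [cite: BhargavaTaniguchiThorne2023, §2.1 (cubic fields are in bijection with their maximal orders)] -/
noncomputable def ringEquivRingOfIntegers (hmax : IsMaximal f) : RingOfForm f ≃+* 𝓞 (RatAlgebra f) :=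
  RingEquiv.ofBijective (toRingOfIntegers f) ⟨toRingOfIntegers_injective, toRingOfIntegers_surjective hmax⟩

end Irreducible

/-! ### `𝓞 K` is a maximal cubic ring -/

section RingOfIntegers

variable {K : Type*} [Field K] [NumberField K]

/-- **The maximal order of a number field is a maximal cubic ring** (for `𝓞 K ≅ R(g)`): an
injective `φ : R(g) → R(h)` has finite index `N` (`exists_pos_forall_exists_eq_mul`), and
`y ↦ φ⁻¹(N y)/N` is a ring homomorphism `R(h) → K` with integral values, hence into `𝓞 K`, which
inverts `φ` (BTT 2023, §2.1: a maximal order is "(ii) a maximal cubic ring"). [cite: BhargavaTaniguchiThorne2023, §2.1 (the maximal order is a maximal cubic ring)] -/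
theorem isMaximal_of_ringEquiv_ringOfIntegers (e : RingOfForm g ≃+* 𝓞 K) : IsMaximal g := by
  classical
  intro h φ hφ
  obtain ⟨N, hN0, hN⟩ := exists_pos_forall_exists_eq_mul hφ
  have hNK : (N : K) ≠ 0 := by exact_mod_cast hN0.ne'
  -- `ι : R(g) → K` through `𝓞 K`
  let ι : RingOfForm g →+* K := (algebraMap (𝓞 K) K).comp e.toRingHom
  have hι : ∀ r, ι r = algebraMap (𝓞 K) K (e r) := fun r => rfl
  have hιinj : Function.Injective ι := (IsFractionRing.injective (𝓞 K) K).comp e.injective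
  -- `ψ y = ι(φ⁻¹(N y)) / N`
  let pre : RingOfForm h → RingOfForm g := fun y => (hN y).choose
  have hpre : ∀ y, φ (pre y) = (N : RingOfForm h) * y := fun y => (hN y).choose_spec
  have huniq : ∀ y r, φ r = (N : RingOfForm h) * y → r = pre y := fun y r hr => hφ (by rw [hr, hpre])
  let ψ₀ : RingOfForm h → K := fun y => (N : K)⁻¹ * ι (pre y)
  have hψ₀ : ∀ y r, φ r = (N : RingOfForm h) * y → ψ₀ y = (N : K)⁻¹ * ι r := by
    intro y r hr; simp only [ψ₀, huniq y r hr]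
  have hpre_mul : ∀ y y', pre y * pre y' = (N : RingOfForm g) * pre (y * y') := by
    intro y y'
    apply hφ
    rw [map_mul, hpre, hpre, map_mul, map_natCast, hpre]; ring
  have hpre_add : ∀ y y', pre y + pre y' = pre (y + y') := by
    intro y y'
    apply hφ
    rw [map_add, hpre, hpre, hpre]; ring
  have hpre_one : pre 1 = (N : RingOfForm g) := by
    symm; apply huniq; rw [map_natCast, mul_one]
  let ψ : RingOfForm h →+* K :=
    { toFun := ψ₀
      map_one' := by
        simp only [ψ₀, hpre_one, map_natCast]
        exact inv_mul_cancel₀ hNK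
      map_mul' := by
        intro y y'
        simp only [ψ₀]
        have h1 : ι (pre y) * ι (pre y') = (N : K) * ι (pre (y * y')) := by
          rw [← map_mul, hpre_mul, map_mul, map_natCast]
        field_simp
        linear_combination -h1
      map_zero' := by
        simp only [ψ₀]
        have h0 : pre 0 = 0 := by symm; apply huniq; rw [map_zero, mul_zero]
        rw [h0, map_zero, mul_zero]
      map_add' := by
        intro y y'
        simp only [ψ₀]
        rw [← hpre_add, map_add]; ring }
  have hψ : ∀ y, ψ y = (N : K)⁻¹ * ι (pre y) := fun y => rfl
  -- values of `ψ` are integral, hence in `𝓞 K`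
  intro y
  have hint : IsIntegral ℤ (ψ y) := (Algebra.IsIntegral.isIntegral (R := ℤ) y).map ψ.toIntAlgHom
  obtain ⟨o, ho⟩ := (IsIntegralClosure.isIntegral_iff (A := 𝓞 K)).mp hint
  -- `N ψ(y) = ι(pre y) = ι(N e⁻¹ o)`, so `pre y = N e⁻¹ o` and `y = φ(e⁻¹ o)`
  refine ⟨e.symm o, ?_⟩
  have h1 : ι (pre y) = ι ((N : RingOfForm g) * e.symm o) := by
    rw [map_mul, map_natCast, hι (e.symm o), RingEquiv.apply_symm_apply, ho, hψ]
    field_simp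
  have h2 : pre y = (N : RingOfForm g) * e.symm o := hιinj h1
  apply natCast_mul_cancel hN0.ne'
  have h3 : φ (pre y) = (N : RingOfForm h) * y := hpre y
  rw [h2, map_mul, map_natCast] at h3
  exact h3

/-- Hence the form of a cubic field (`CubicFieldForms`) is maximal, and lies in `U_p` for every
`p` (Prop. 2.2). [folklore] -/
theorem memU_of_ringEquiv_ringOfIntegers (e : RingOfForm g ≃+* 𝓞 K) {p : ℕ} (hp : 1 < p) : g.MemU p :=
  memU_of_isMaximal (isMaximal_of_ringEquiv_ringOfIntegers e) hp

end RingOfIntegers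

/-! ### BTT §2.1: maximal orders of cubic fields = maximal cubic integral domains -/

/-- **BTT 2023, §2.1 (i)+(ii):** `R(f)` is an integral domain and a maximal cubic ring if and only
if `R(f) ≅ 𝓞 K` for some cubic number field `K` (namely `K = K_f = Frac R(f)`). [cite: BhargavaTaniguchiThorne2023, §2.1 (R is the maximal order of a cubic field iff (i) integral domain and (ii) maximal)] -/
theorem isMaximal_and_isIrreducible_iff :
    (IsMaximal f ∧ f.IsIrreducible) ↔
      ∃ (K : Type) (_ : Field K) (_ : NumberField K), Module.finrank ℚ K = 3 ∧ Nonempty (RingOfForm f ≃+* 𝓞 K) := by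
  constructor
  · rintro ⟨hmax, hirr⟩
    haveI : Fact f.IsIrreducible := ⟨hirr⟩
    exact ⟨RatAlgebra f, inferInstance, inferInstance, finrank_ratAlgebra_eq_three, ⟨ringEquivRingOfIntegers hmax⟩⟩
  · rintro ⟨K, _, _, -, ⟨e⟩⟩
    exact ⟨isMaximal_of_ringEquiv_ringOfIntegers e, isIrreducible_of_ringEquiv_ringOfIntegers e⟩

/-- **With Prop. 2.2:** `f` is irreducible over `ℚ` and `f ∈ U_p` for all primes `p` if and only if
`R(f)` is the maximal order of a cubic number field — the forms counted by Davenport–Heilbronn for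
`N₃(X)` (BTT 2023, §2.2). [cite: BhargavaTaniguchiThorne2023, §2.2 (cubic fields ↔ GL₂(ℤ)-orbits of irreducible forms in U_p for all p)] -/
theorem memU_and_isIrreducible_iff :
    ((∀ p : ℕ, p.Prime → f.MemU p) ∧ f.IsIrreducible) ↔
      ∃ (K : Type) (_ : Field K) (_ : NumberField K), Module.finrank ℚ K = 3 ∧ Nonempty (RingOfForm f ≃+* 𝓞 K) := by
  rw [← isMaximal_iff_memU]
  exact isMaximal_and_isIrreducible_iff

end RingOfForm

end Literature.NumberTheory.CubicFields
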